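import Literature.NumberTheory.IwasawaTheory.ClassicalMuVanishesDivisionFieldFive
import Literature.NumberTheory.EllipticCurves.FineSelmerClassGroupCriterion
import HarnessLib

set_option autoImplicit false

/-!
# Statement (A) of Coates–Sujatha at `p = 5` for curves with split-Cartan-normaliser mod-5 image, from `μ = 0` of four subfields
# of `ℚ(E[5])` (road (b): `CoatesSujatha2005.thm34` ∘ `ClassicalMuVanishesDivisionFieldFive`)

Topic `NumberTheory/EllipticCurves`; THEOREM-ONLY file (no definition, no named fact, no `sorry`); literature seat `bsd-potss-conjA-anchor`
g11 (supports the KT fine-Selmer crux stmt-BirchSwinnertonDyer-19413 and its residue parent 19916, rows with split Cartan image at `5`;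
closes nothing).  The composite of the named fact `CoatesSujatha2005.thm34_fineSelmerDual_moduleFinite_of_classicalMuVanishes_divisionField`
(road (b)) with `classicalMuVanishes_divisionField_of_splitCartanBasis_five`: statement (A) for `E` at `5` (`Sel₀(E/ℚ_cyc)^∨` finitely
generated over `ℤ_5`, in the tree's `∃ γ D, Module.Finite ℤ_[5] D.X` form) from a split-Cartan basis `e` of `E[5]`, three elements
`σ_u, σ_v, σ_w ∈ Γ_ℚ` acting as `diag(2,1)`, `diag(1,2)`, `(0 1; 1 0)`, «`μ = 0`» for the four fields `ℚ(P₁)`, `ℚ(E[5])^{⟨σ̄_u²σ̄_v⟩}`,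
`ℚ(x P₁)`, `ℚ(⟨P₁+P₂⟩)` (as fixed fields), Ferrero–Washington and Coates–Sujatha Thm. 3.4 — no growth theorem.

References: [CoatesSujatha2005, Thm. 3.4]; [KuriharaPollack2007, §3.1]; [Lemmermeyer1994, §1]; [Washington1997, §7.5, §13.1]; [Serre1972, §2.2].
-/

noncomputable section

open scoped NumberField Matrix

open Field IntermediateField WeierstrassCurve Literature.NumberTheory.EllipticCurves Literature.NumberTheory.GaloisRepresentations
  Literature.NumberTheory.SerreUniformity Literature.NumberTheory.IwasawaTheory

namespace Literature.NumberTheory.EllipticCurves.CoatesSujatha2005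

/-- **Statement (A) at `5` for split-Cartan-normaliser image, from `μ = 0` of `ℚ(P₁)`, `ℚ(E[5])^{⟨σ̄_u²σ̄_v⟩}`, `ℚ(x P₁)`, `ℚ(⟨P₁+P₂⟩)`**
(modulo Coates–Sujatha Thm. 3.4 and Ferrero–Washington, both named facts): with `e`, `σ_u, σ_v, σ_w` and the four `μ`-inputs as in
`classicalMuVanishes_divisionField_of_splitCartanBasis_five`, for every cyclotomic `ℤ_5`-extension `κ` of `ℚ` the dual fine Selmer group
of `E` over `ℚ_cyc` is finitely generated over `ℤ_5`.
[cite: CoatesSujatha2005, Thm. 3.4 (§3)] [cite: KuriharaPollack2007, §3.1] [cite: Lemmermeyer1994, §1 (Kuroda's class number formula)] -/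
theorem fineSelmerDual_moduleFinite_of_splitCartanBasis_five
    (hCS : thm34_fineSelmerDual_moduleFinite_of_classicalMuVanishes_divisionField)
    (hFW : ferreroWashington1979_classicalMuVanishes) [Fact (Nat.Prime 5)] (W : WeierstrassCurve ℚ) [W.IsElliptic]
    (e : W.geomTorsion (5 : ℕ) ≃+ (Fin 2 → ZMod 5))
    (he : ∀ σ : absoluteGaloisGroup ℚ, ∃ M ∈ splitCartanNormalizer 5, ∀ P : W.geomTorsion (5 : ℕ), e (σ • P) = M *ᵥ e P)
    (σu σv σw : absoluteGaloisGroup ℚ) (hσu : ∀ P : W.geomTorsion (5 : ℕ), e (σu • P) = !![2, 0; 0, 1] *ᵥ e P)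
    (hσv : ∀ P : W.geomTorsion (5 : ℕ), e (σv • P) = !![1, 0; 0, 2] *ᵥ e P)
    (hσw : ∀ P : W.geomTorsion (5 : ℕ), e (σw • P) = !![0, 1; 1, 0] *ᵥ e P)
    (hμP : ∀ κE : ZpExtension ↥(fixedField (Subgroup.zpowers (absRestrictNormalHom (W.divisionField 5) σv))) 5,
      κE.IsCyclotomic → ClassicalMuVanishes κE)
    (hμD : ∀ κE : ZpExtension ↥(fixedField (Subgroup.zpowers (absRestrictNormalHom (W.divisionField 5) σu *
        absRestrictNormalHom (W.divisionField 5) σu * absRestrictNormalHom (W.divisionField 5) σv))) 5,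
      κE.IsCyclotomic → ClassicalMuVanishes κE)
    (hμX : ∀ κE : ZpExtension ↥(fixedField (Subgroup.zpowers (absRestrictNormalHom (W.divisionField 5) σu *
        absRestrictNormalHom (W.divisionField 5) σu) ⊔ Subgroup.zpowers (absRestrictNormalHom (W.divisionField 5) σv))) 5,
      κE.IsCyclotomic → ClassicalMuVanishes κE)
    (hμC : ∀ κE : ZpExtension ↥(fixedField (Subgroup.zpowers (absRestrictNormalHom (W.divisionField 5) σu *
        absRestrictNormalHom (W.divisionField 5) σv) ⊔ Subgroup.zpowers (absRestrictNormalHom (W.divisionField 5) σw))) 5,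
      κE.IsCyclotomic → ClassicalMuVanishes κE)
    (κ : ZpExtension ℚ 5) (hκ : κ.IsCyclotomic) :
    ∃ (γ : absoluteGaloisGroup ℚ) (D : W.FineSelmerDualData κ γ), Module.Finite ℤ_[5] (RestrictScalars ℤ_[5] (IwasawaAlgebra 5) D.X) :=
  hCS W 5 (by decide)
    (classicalMuVanishes_divisionField_of_splitCartanBasis_five hFW W e he σu σv σw hσu hσv hσw hμP hμD hμX hμC) κ hκ

end Literature.NumberTheory.EllipticCurves.CoatesSujatha2005

end
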